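import Summits.BirchSwinnertonDyer.BirchSwinnertonDyer.Theorems.KimAtThreeD7uTamagawaIndexCorollaries
import Summits.BirchSwinnertonDyer.Rank1Residual.GaloisImage.KolyvaginSystemsCoreRankZero
import Summits.BirchSwinnertonDyer.Rank1Residual.GaloisImage.KolyvaginCoreGraphPair
import Summits.BirchSwinnertonDyer.Rank1Residual.GaloisImage.SelmerGroupFinite
import Summits.BirchSwinnertonDyer.Rank1Residual.GaloisImage.SakamotoN11InstanceLevelOneLocal
import Literature.NumberTheory.EllipticCurves.LeadingTermTamagawaProofs
import HarnessLib

/-!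
# The TAMAGAWA-DIVISIBLE bad places, IX: the exponent-ONE Tamagawa DEFECT — when `p ∣ c_ℓ`, every
# Kolyvagin system for [MR04]'s `𝓕_u` on `E[p]` VANISHES ([MR04] Prop. 6.2.6 / Büyükboduk 2009 Thm. 3.1, `n = 1`)
# (cell `bsd-addord`, seat w2-tamdiv gen 4; route W2 `KimAtThreeKolyvagin`, items 19562 / 19560, «TamDiv∞»)

HONEST FRAMING: TOOL theorems (no definition, no named fact, no `sorry`); closes nothing by itself;
nothing is booked; BSD is not proved by any of this.  CONDITIONAL on named binders exactly as n1011's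
core-rank-zero vanishing (`CoreRankZero.kolyvaginSystems_eq_bot_of_hasCoreRank_zero_of_infinite`, Rubin PCMI
Thm. 2.7.6 / [MR04] Thm. 4.2.2 at `k = 1`): the Poitou–Tate family `inv` (`IsPerfect`, `SumLocalTermEqZero`,
`SelmerComplement`), the core rank ONE of `𝓕_can` on `E[p^0 · p]` (`hχ1`; DISCHARGED at `p = 3` in §3 by
n1011's theorem from Tate's local Euler–Poincaré characteristic `hEP`), the Kolyvagin-datum shape (`hPT`,
`hadm`, `hU`, `hT`, `hUT`) and the prime choice (`hprime`, Chebotarev).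

## What

* §1 (any number field, any finite module killed by `p`) **`hasCoreRank_zero_of_index_eq`**: if Selmer
  structures `𝓕 ≤ 𝓖` agree except at one finite place `ℓ ∈ T` where `#𝓖_ℓ = p · #𝓕_ℓ`, and `χ(𝓖) = 1`, then
  `χ(𝓕) = 0` (the relative Poitou–Tate pair count `card_selmerGroup_pair`, n1011; Büyükboduk's Cor. 2.8 count
  «`0 ≤ χ(𝒢) < χ(𝓕) = 1`» at `n = 1`); `exists_le_index_eq_of_lt` (index-`p` overgroups in an `𝔽_p`-space);
  `kolyvaginSystems_mono` (`KS` is monotone in the Selmer structure).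
* §2 **`kolyvaginSystems_eq_bot_of_dvd_localTamagawaNumber`** (E/ℚ, `E[p^0 · p]`, a finite `ℓ ∤ p` with
  `p ∣ c_ℓ`, `T ⊇ {p} ∪ {bad}`): for every Selmer structure `𝓕₀ ≤ 𝓕_can` whose condition at `ℓ` lies in
  [MR04]'s `𝓕_u(ℓ)` — e.g. `𝓕_u` itself, for which gen 2 proved that Kato-type Euler systems give Kolyvagin
  systems (`KimAtThreeD7uKolyvaginPairBlochKato`) — **`KS(E[p], 𝓕₀, 𝒫) = 0`**: by part VIII
  `𝓕_u(ℓ) ⊊ 𝓕_can(ℓ)`, so `𝓕₀ ≤ 𝓕′ := (𝓕_can with an index-p condition at ℓ containing 𝓕_u(ℓ))`, `χ(𝓕′) = 0`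
  (§1), and n1011's vanishing theorem applies to `𝓕′`.  Hence the derivative classes `κ_n` of such an Euler
  system all vanish in `H¹(ℚ, E[p])` — `κ` is NOT primitive — whenever `p` divides a Tamagawa number: [MR04]
  Prop. 6.2.6 for ALL reduction types and `p = 3` allowed (there: `p > 3`, split multiplicative).
* §3 **`kolyvaginSystems_eq_bot_of_three_dvd_localTamagawaNumber`**: `p = 3`, `hχ1` discharged.

References: B. Mazur, K. Rubin, Mem. AMS 799 (2004) Prop. 6.2.6, Thm. 4.2.2, App. A Remark A.5;
K. Büyükboduk, JNT 129 (2009) Prop. 2.7, Cor. 2.8, Thm. 3.1; K. Rubin, PCMI 18 (2011) Thm. 2.7.6.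
-/

noncomputable section

-- the cell's Theorems namespace `Summit.BirchSwinnertonDyer.BirchSwinnertonDyer.…` repeats the summit name by design (D-0017)
set_option linter.dupNamespace false

open scoped Classical NumberField
open Function Field IsDedekindDomain NumberField
open Literature.NumberTheory.GaloisRepresentations Literature.NumberTheory.EllipticCurves
open Literature.NumberTheory.GaloisRepresentations.DiscreteGaloisModule Literature.NumberTheory.GaloisCohomology
open WeierstrassCurve
open Summit.BirchSwinnertonDyer.Rank1Residual.GaloisImage

namespace Summit.BirchSwinnertonDyer.BirchSwinnertonDyer.Theorems.KimAtThreeD7uTamagawaDefect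

universe u

/-! ### §1 Core rank drops by one at an index-`p` sub-condition; index-`p` overgroups; monotonicity of `KS` -/

section Abstract

variable {K : Type u} [Field K] [NumberField K] {M : Type u} [AddCommGroup M] [TopologicalSpace M]
  [DiscreteTopology M] [Finite M] {ρ : DiscreteGaloisModule K M} {p : ℕ} [hp : Fact p.Prime]

/-- **Core rank drops from `1` to `0` at an index-`p` sub-condition** (Büyükboduk 2009 Cor. 2.8 at `n = 1`):
`𝓕 ≤ 𝓖` Selmer structures on a finite module killed by `p`, equal except at the finite place `ℓ ∈ T` where
`#𝓖_ℓ = p · #𝓕_ℓ`, both unramified outside `finSupport T`; if `#H¹_𝓖 = p · #H¹_{𝓖^*}` then `#H¹_𝓕 = #H¹_{𝓕^*}` —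
the relative Poitou–Tate count `#H¹_𝓖 · #H¹_{𝓕^*} · ∏_T #𝓕_v = #H¹_𝓕 · #H¹_{𝓖^*} · ∏_T #𝓖_v`
(`card_selmerGroup_pair`). [cite: MazurRubin2004, Prop. 2.3.5 and Prop. 6.2.6 (p. 75)] -/
theorem hasCoreRank_zero_of_index_eq {inv : LocalInvariants K p}
    (hperf : inv.IsPerfect) (hsum : inv.SumLocalTermEqZero) (hcompl : inv.SelmerComplement)
    (hM : ∀ m : M, p • m = 0) (T : Finset (HeightOneSpectrum (𝓞 K)))
    (hS : ∀ v : HeightOneSpectrum (𝓞 K), v ∉ T → ((p : ℕ) : 𝓞 K) ∉ v.asIdeal ∧ GaloisRep.IsUnramifiedAt v ρ)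
    {𝓕 𝓖 : SelmerStructure ρ} (hle : 𝓕 ≤ 𝓖) (h𝓕 : 𝓕.IsUnramifiedOutside (finSupport T))
    (h𝓖 : 𝓖.IsUnramifiedOutside (finSupport T)) {ℓ : HeightOneSpectrum (𝓞 K)} (hℓ : ℓ ∈ T)
    (heq : ∀ v : Place K, v ≠ Sum.inr ℓ → 𝓕 v = 𝓖 v)
    (hidx : Nat.card (𝓖 (Sum.inr ℓ)) = p * Nat.card (𝓕 (Sum.inr ℓ)))
    (hfind : Finite (inv.dualSelmerStructure ρ 𝓖).selmerGroup)
    (hχ : LocalInvariants.HasCoreRank inv 𝓖 p 1) :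
    LocalInvariants.HasCoreRank inv 𝓕 p 0 := by
  haveI : NeZero p := ⟨hp.out.ne_zero⟩
  have hpair := card_selmerGroup_pair ρ T inv hperf hsum hcompl hM hS hle h𝓕 h𝓖
    (fun w => heq _ (by simp))
  -- the local products differ by the factor `p` at `ℓ`
  haveI hfinloc : ∀ v : HeightOneSpectrum (𝓞 K), Finite (galoisCohomology (ρ.toLocal (Sum.inr v)) 1) :=
    fun v => finite_galoisCohomology_one_toLocal ρ v
  have hprod : ∏ v ∈ T, Nat.card (𝓖 (Sum.inr v)) = p * ∏ v ∈ T, Nat.card (𝓕 (Sum.inr v)) := by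
    rw [← Finset.mul_prod_erase T _ hℓ, ← Finset.mul_prod_erase T _ hℓ, hidx, mul_assoc]
    congr 2
    refine Finset.prod_congr rfl fun v hv => ?_
    rw [heq _ (fun h => (Finset.ne_of_mem_erase hv) (Sum.inr_injective h))]
  have hP0 : ∏ v ∈ T, Nat.card (𝓕 (Sum.inr v)) ≠ 0 := by
    refine Finset.prod_ne_zero_iff.mpr fun v _ => ?_
    haveI : Finite (𝓕 (Sum.inr v)) := inferInstance
    haveI : Nonempty (𝓕 (Sum.inr v)) := ⟨0⟩
    exact (Nat.card_pos (α := 𝓕 (Sum.inr v))).ne'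
  haveI : Nonempty (inv.dualSelmerStructure ρ 𝓖).selmerGroup := ⟨0⟩
  have hd0 : Nat.card (inv.dualSelmerStructure ρ 𝓖).selmerGroup ≠ 0 := Nat.card_pos.ne'
  -- `#H¹_𝓖 = p · #H¹_{𝓖^*}`
  rw [LocalInvariants.HasCoreRank, pow_one] at hχ
  rw [LocalInvariants.HasCoreRank, pow_zero, one_mul]
  rw [hχ, hprod] at hpair
  -- cancel `p · #H¹_{𝓖^*} · ∏ #𝓕_v`
  have h : Nat.card (inv.dualSelmerStructure ρ 𝓕).selmerGroup *
      (p * Nat.card (inv.dualSelmerStructure ρ 𝓖).selmerGroup * ∏ v ∈ T, Nat.card (𝓕 (Sum.inr v))) =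
      Nat.card 𝓕.selmerGroup *
      (p * Nat.card (inv.dualSelmerStructure ρ 𝓖).selmerGroup * ∏ v ∈ T, Nat.card (𝓕 (Sum.inr v))) := by
    calc _ = p * Nat.card (inv.dualSelmerStructure ρ 𝓖).selmerGroup *
          Nat.card (inv.dualSelmerStructure ρ 𝓕).selmerGroup * ∏ v ∈ T, Nat.card (𝓕 (Sum.inr v)) := by ring
      _ = Nat.card 𝓕.selmerGroup * Nat.card (inv.dualSelmerStructure ρ 𝓖).selmerGroup *
          (p * ∏ v ∈ T, Nat.card (𝓕 (Sum.inr v))) := hpair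
      _ = _ := by ring
  have hne : p * Nat.card (inv.dualSelmerStructure ρ 𝓖).selmerGroup * ∏ v ∈ T, Nat.card (𝓕 (Sum.inr v)) ≠ 0 :=
    mul_ne_zero (mul_ne_zero hp.out.ne_zero hd0) hP0
  exact (Nat.eq_of_mul_eq_mul_right (Nat.pos_of_ne_zero hne) h).symm

omit [NumberField K] [TopologicalSpace M] [DiscreteTopology M] [Finite M] in
/-- In an abelian group killed by `p`, a PROPER subgroup `H < G'` of a finite subgroup `G'` lies in a subgroup
`F ≤ G'` with `#G' = p · #F` (`G'/H` is a non-zero `𝔽_p`-space; take the kernel of a non-zero functional). [folklore] -/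
theorem exists_le_index_eq_of_lt {A : Type*} [AddCommGroup A] (hA : ∀ a : A, p • a = 0)
    {H G' : AddSubgroup A} [Finite G'] (hlt : H < G') :
    ∃ F : AddSubgroup A, H ≤ F ∧ F ≤ G' ∧ Nat.card G' = p * Nat.card F := by
  have hpp : p.Prime := hp.out
  -- the quotient `G'/H'` as an `𝔽_p`-vector space
  have hV : ∀ x : G' ⧸ H.addSubgroupOf G', p • x = 0 := by
    intro x
    obtain ⟨g, rfl⟩ := QuotientAddGroup.mk_surjective x
    rw [← QuotientAddGroup.mk_nsmul, show p • g = 0 from Subtype.ext (by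
      rw [AddSubgroup.coe_nsmul, AddSubgroup.coe_zero]; exact hA _), QuotientAddGroup.mk_zero]
  letI : Module (ZMod p) (G' ⧸ H.addSubgroupOf G') := AddCommGroup.zmodModule hV
  haveI hfree : Module.Free (ZMod p) (G' ⧸ H.addSubgroupOf G') :=
    Module.Free.of_divisionRing (ZMod p) (G' ⧸ H.addSubgroupOf G')
  haveI hproj : Module.Projective (ZMod p) (G' ⧸ H.addSubgroupOf G') :=
    @Module.Projective.of_free (ZMod p) _ (G' ⧸ H.addSubgroupOf G') _ _ hfree
  -- a vector outside `0`: the class of some `g ∈ G' ∖ H`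
  obtain ⟨g, hgG, hgH⟩ := SetLike.exists_of_lt hlt
  have hv0 : (QuotientAddGroup.mk (⟨g, hgG⟩ : G') : G' ⧸ H.addSubgroupOf G') ≠ 0 := by
    rw [Ne, QuotientAddGroup.eq_zero_iff]
    exact fun h => hgH (AddSubgroup.mem_addSubgroupOf.mp h)
  obtain ⟨φ, hφ⟩ := @Module.Projective.exists_dual_ne_zero _ _ (ZMod p) _ _ hproj _ hv0
  -- `g₀ = φ ∘ mk : G' → 𝔽_p` is onto
  have hg₀ : ∀ x : G', (φ.toAddMonoidHom.comp (QuotientAddGroup.mk' (H.addSubgroupOf G'))) x =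
      φ.toAddMonoidHom (QuotientAddGroup.mk x) := fun _ => rfl
  haveI : Fact (Nat.card (ZMod p)).Prime := ⟨by rw [Nat.card_zmod]; exact hpp⟩
  have hrange : (φ.toAddMonoidHom.comp (QuotientAddGroup.mk' (H.addSubgroupOf G'))).range = ⊤ := by
    rcases (φ.toAddMonoidHom.comp
      (QuotientAddGroup.mk' (H.addSubgroupOf G'))).range.eq_bot_or_eq_top_of_prime_card with h | h
    · exfalso; apply hφ
      have hmem : (φ.toAddMonoidHom.comp (QuotientAddGroup.mk' (H.addSubgroupOf G'))) ⟨g, hgG⟩ ∈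
          (φ.toAddMonoidHom.comp (QuotientAddGroup.mk' (H.addSubgroupOf G'))).range := ⟨_, rfl⟩
      rw [h, AddSubgroup.mem_bot] at hmem
      exact hmem
    · exact h
  have hidx : (φ.toAddMonoidHom.comp (QuotientAddGroup.mk' (H.addSubgroupOf G'))).ker.index = p := by
    rw [AddSubgroup.index_ker, hrange, AddSubgroup.card_top, Nat.card_zmod]
  -- `F = ker g₀ ≤ G'`, pushed to `A`
  refine ⟨(φ.toAddMonoidHom.comp (QuotientAddGroup.mk' (H.addSubgroupOf G'))).ker.map G'.subtype,
    fun h hh => ?_, fun x hx => ?_, ?_⟩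
  · refine AddSubgroup.mem_map.mpr ⟨⟨h, hlt.le hh⟩, ?_, rfl⟩
    rw [AddMonoidHom.mem_ker, hg₀, (QuotientAddGroup.eq_zero_iff _).mpr
      (AddSubgroup.mem_addSubgroupOf.mpr hh), map_zero]
  · obtain ⟨y, -, rfl⟩ := hx
    exact y.2
  · rw [Nat.card_congr ((φ.toAddMonoidHom.comp
        (QuotientAddGroup.mk' (H.addSubgroupOf G'))).ker.equivMapOfInjective G'.subtype
        G'.subtype_injective).toEquiv.symm]
    have hci := AddSubgroup.card_mul_index
      (φ.toAddMonoidHom.comp (QuotientAddGroup.mk' (H.addSubgroupOf G'))).ker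
    rw [hidx] at hci
    rw [← hci, mul_comm]

omit [Finite M] hp in
/-- **`KS` is monotone in the Selmer structure**: a Kolyvagin system for `𝓕` is one for any `𝓖 ≥ 𝓕`
(the transverse conditions and finite–singular relations do not involve `𝓕`). [cite: Rubin2011, Def. 2.2.1 (p. 18)] -/
theorem kolyvaginSystems_mono (D : KolyvaginDatum ρ) {𝓕 𝓖 : SelmerStructure ρ} (h : 𝓕 ≤ 𝓖) :
    D.kolyvaginSystems 𝓕 ≤ D.kolyvaginSystems 𝓖 := by
  intro κ hκ
  have hle : ∀ d : Finset (HeightOneSpectrum (𝓞 K)), D.atLevel 𝓕 d ≤ D.atLevel 𝓖 d := by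
    intro d v
    cases v with
    | inl w => exact h (Sum.inl w)
    | inr q =>
      change 𝓕.modify D.transverse ∅ ∅ d (Sum.inr q) ≤ 𝓖.modify D.transverse ∅ ∅ d (Sum.inr q)
      rw [SelmerStructure.modify_inr, SelmerStructure.modify_inr]
      simp only [Finset.notMem_empty, if_false]
      split_ifs
      · exact le_rfl
      · exact h (Sum.inr q)
  exact ⟨hκ.eq_zero_of_not_isLevel, fun d hd => CoreRankZero.selmerGroup_mono (hle d)
    (hκ.mem_selmerGroup d hd), hκ.fs_rel⟩

end Abstract

/-! ### §2 The exponent-one Tamagawa defect for `E/ℚ` -/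

section RationalCurve

variable (W : WeierstrassCurve ℚ) [W.IsElliptic] (p : ℕ) [hp : Fact p.Prime]

/-- `E[p^0 · p]` with its `Γ_ℚ`-action (the module of `propagatedSelmerStructure W p 0`). -/
local notation3 "ρ₁" => WeierstrassCurve.torsionGaloisModule W ((p : ℤ) ^ 0 * (p : ℤ))

omit [W.IsElliptic] hp in
/-- `E[p^0 · p]` is killed by `p`. [folklore] -/
theorem nsmul_geomTorsion_pow_zero_mul_eq_zero (m : geomTorsion W ((p : ℤ) ^ 0 * (p : ℤ))) :
    p • m = 0 := by
  have h : ((p : ℤ) ^ 0 * (p : ℤ)) • (m : geomPoints W) = 0 := (Submodule.mem_torsionBy_iff _ _).mp m.2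
  simp only [pow_zero, one_mul, natCast_zsmul] at h
  exact Subtype.ext (by rw [AddSubgroup.coe_nsmul, AddSubgroup.coe_zero]; exact h)

/-- **The exponent-ONE Tamagawa defect** ([MR04] Prop. 6.2.6 for every reduction type, `p = 3` allowed;
Büyükboduk 2009 Thm. 3.1 at `n = 1`; the Kolyvagin-system form of «TamDiv∞» at exponent one).  `E/ℚ`, a
prime `p`, a finite place `ℓ ∤ p` whose Tamagawa number `c_ℓ` is divisible by `p` (so `ℓ` is bad), a finite
set `T ⊇ {p} ∪ {bad}` of finite places.  Let `𝓕_can` be the canonical (propagated) Selmer structure on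
`E[p^0 · p] = E[p]` — unramified outside `S(T)` (n1011's `propagatedSelmerStructure_isUnramifiedOutside`, no
hypothesis) — of core rank one (`hχ1`, the one global input; at `p = 3` n1011 discharges it, §3); let
`𝒫, (H¹_tr(ℚ_q))` be a Kolyvagin datum off `T` of the printed local shape with Rubin's prime-choice property
(`hprime`).  Then for EVERY Selmer structure `𝓕₀ ≤ 𝓕_can` whose local condition at `ℓ` lies in [MR04]'s
unramified/finite condition `𝓕_u(ℓ) = H¹_f(ℚ_ℓ, E[p])` — in particular for `𝓕_u` itself —
**`KS(E[p], 𝓕₀, 𝒫) = 0`**.  Proof: `𝓕_u(ℓ) ⊊ 𝓕_can(ℓ)` (part VIII, from `p ∣ c_ℓ = #Φ_ℓ`), so `𝓕_u(ℓ)`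
lies in an index-`p` subgroup `F′ < 𝓕_can(ℓ)`; the structure `𝓕′ = (𝓕_can off ℓ, F′ at ℓ)` has core
rank `0` (§1, Poitou–Tate; the dual Selmer group of `𝓕_can` is finite because `χ(𝓕_can) = 1` is an
identity of positive orders), hence `KS(𝓕′) = 0` (Rubin Thm. 2.7.6, n1011), and `KS(𝓕₀) ≤ KS(𝓕′)`.  (The binder
`Finite E[p^0 · p]` is the tree's `finite_torsionPoints_holds`.) [cite: MazurRubin2004, Prop. 6.2.6 and Remark A.5 (pp. 75, 91)] -/
theorem kolyvaginSystems_eq_bot_of_dvd_localTamagawaNumber [Finite (geomTorsion W ((p : ℤ) ^ 0 * (p : ℤ)))]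
    {inv : LocalInvariants ℚ p}
    (hperf : inv.IsPerfect) (hsum : inv.SumLocalTermEqZero) (hcompl : inv.SelmerComplement)
    (T : Finset (HeightOneSpectrum (𝓞 ℚ)))
    (hpT : ∀ v : HeightOneSpectrum (𝓞 ℚ), ((p : ℕ) : 𝓞 ℚ) ∈ v.asIdeal → v ∈ T)
    (hbadT : ∀ v : HeightOneSpectrum (𝓞 ℚ), ¬ W.HasGoodReductionAt v → v ∈ T)
    (hχ1 : LocalInvariants.HasCoreRank inv (propagatedSelmerStructure W p 0) p 1)
    {ℓ : HeightOneSpectrum (𝓞 ℚ)} (hℓp : ((p : ℕ) : 𝓞 ℚ) ∉ ℓ.asIdeal)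
    (hc : p ∣ (W.baseChange (ℓ.adicCompletion ℚ)).localTamagawaNumber (ℓ.adicCompletionIntegers ℚ))
    (L : (tateTorsionDatum W p 0).LocalConditionsAbove p)
    {𝓕₀ : SelmerStructure ρ₁} (h₀ : 𝓕₀ ≤ propagatedSelmerStructure W p 0)
    (h₀ℓ : 𝓕₀ (Sum.inr ℓ) ≤ blochKatoSelmerStructure p (tateTorsionDatum W p 0) L (Sum.inr ℓ))
    {D : KolyvaginDatum ρ₁} (hPT : ∀ q ∈ D.primes, q ∉ T) (hadm : D.IsAdmissible)
    (hU : ∀ q ∈ D.primes, Nat.card (unramifiedSubgroup (GaloisRep.toLocal q ρ₁) 1) = p)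
    (hT : ∀ q ∈ D.primes, Nat.card (D.transverse (Sum.inr q)) = p)
    (hUT : ∀ q ∈ D.primes, unramifiedSubgroup (GaloisRep.toLocal q ρ₁) 1 ⊔ D.transverse (Sum.inr q) = ⊤)
    (hprime : ∀ c : galoisCohomology ρ₁ 1, c ≠ 0 →
      ∀ c' : galoisCohomology (DiscreteGaloisModule.tateDual ρ₁ p) 1, c' ≠ 0 →
      {q ∈ D.primes | galoisCohomology.localization ρ₁ (Sum.inr q) 1 c ≠ 0 ∧
        galoisCohomology.localization (DiscreteGaloisModule.tateDual ρ₁ p) (Sum.inr q) 1 c' ≠ 0}.Infinite) :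
    D.kolyvaginSystems 𝓕₀ = ⊥ := by
  haveI : NeZero p := ⟨hp.out.ne_zero⟩
  have hM : ∀ m : geomTorsion W ((p : ℤ) ^ 0 * (p : ℤ)), p • m = 0 :=
    nsmul_geomTorsion_pow_zero_mul_eq_zero W p
  -- Step 0: `𝓕_can` is unramified outside `S(T)`, `E[p]` is unramified off `T` (n1011-p13), `ℓ ∈ T`
  have hpS := fun v (hv : ((p : ℕ) : 𝓞 ℚ) ∈ v.asIdeal) => (inr_mem_finSupport_iff T v).mpr (hpT v hv)
  have hbadS := fun v (hv : ¬ W.HasGoodReductionAt v) => (inr_mem_finSupport_iff T v).mpr (hbadT v hv)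
  have hcan : (propagatedSelmerStructure W p 0).IsUnramifiedOutside (finSupport T) :=
    propagatedSelmerStructure_isUnramifiedOutside W p 0 (finSupport T) (inl_mem_finSupport T) hpS hbadS
  have hS' : ∀ v : HeightOneSpectrum (𝓞 ℚ), (Sum.inr v : Place ℚ) ∉ finSupport T →
      ((p : ℕ) : 𝓞 ℚ) ∉ v.asIdeal ∧ GaloisRep.IsUnramifiedAt v ρ₁ :=
    fun v hvS => not_mem_and_isUnramifiedAt_of_not_mem W p 0 (finSupport T) hpS hbadS hvS
  have hS : ∀ v : HeightOneSpectrum (𝓞 ℚ), v ∉ T → ((p : ℕ) : 𝓞 ℚ) ∉ v.asIdeal ∧ GaloisRep.IsUnramifiedAt v ρ₁ :=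
    fun v hv => hS' v (fun h => hv ((inr_mem_finSupport_iff T v).mp h))
  have hℓT : ℓ ∈ T := by
    refine hbadT ℓ fun hgood => ?_
    have h1 := localTamagawaNumber_eq_one_of_good_holds W ℓ hgood
    rw [h1] at hc
    exact hp.out.one_lt.ne' (Nat.dvd_one.mp hc)
  -- the dual Selmer group of `𝓕_can` is finite: `#H¹_{𝓕_can} = p · #H¹_{𝓕_can^*}` with `H¹_{𝓕_can}` finite
  haveI hfincan : Finite (propagatedSelmerStructure W p 0).selmerGroup :=
    SelmerFinite.finite_selmerGroup_of_isUnramifiedOutside _ (fun v hv => (hS' v hv).2) hcan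
  have hfind : Finite (inv.dualSelmerStructure ρ₁ (propagatedSelmerStructure W p 0)).selmerGroup := by
    refine Nat.finite_of_card_ne_zero fun h0 => ?_
    have h1 := hχ1
    rw [LocalInvariants.HasCoreRank, h0, mul_zero] at h1
    exact (Nat.card_pos (α := (propagatedSelmerStructure W p 0).selmerGroup)).ne' h1
  -- Step 1 (part VIII): `𝓕_u(ℓ) ⊊ 𝓕_can(ℓ)` since `p ∣ c_ℓ`
  have hlt : blochKatoSelmerStructure p (tateTorsionDatum W p 0) L (Sum.inr ℓ) <
      propagatedSelmerStructure W p 0 (Sum.inr ℓ) :=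
    KimAtThreeD7uTamagawaIndex.blochKatoSelmerStructure_lt_propagatedSelmerStructure_of_dvd_localTamagawaNumber
      W p 0 ℓ L hℓp hc
  -- Step 2: an index-`p` subgroup `𝓕_u(ℓ) ≤ F′ < 𝓕_can(ℓ)` (`H¹(ℚ_ℓ, E[p])` is killed by `p`)
  haveI := KimAtThreeD7uTamagawaIndex.finite_propagatedSelmerStructure_inr W p 0 ℓ hℓp
  obtain ⟨F', hF'u, hF'can, hF'idx⟩ := exists_le_index_eq_of_lt (p := p)
    (fun a => galoisCohomology.nsmul_eq_zero_of_forall (DiscreteGaloisModule.toLocal ρ₁ (Sum.inr ℓ)) hM a) hlt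
  -- Step 3: the structure `𝓕′ = (𝓕_can off ℓ, F′ at ℓ)`
  obtain ⟨𝓕', h𝓕'ℓ, heq'⟩ : ∃ 𝓕' : SelmerStructure ρ₁, 𝓕' (Sum.inr ℓ) = F' ∧
      ∀ v : Place ℚ, v ≠ Sum.inr ℓ → 𝓕' v = propagatedSelmerStructure W p 0 v :=
    ⟨Function.update (propagatedSelmerStructure W p 0) (Sum.inr ℓ) F', Function.update_self .., fun v hv =>
      Function.update_of_ne hv ..⟩
  have hle' : 𝓕' ≤ propagatedSelmerStructure W p 0 := by
    intro v
    by_cases hv : v = Sum.inr ℓ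
    · subst hv; rw [h𝓕'ℓ]; exact hF'can
    · rw [heq' v hv]
  have h𝓕'ur : 𝓕'.IsUnramifiedOutside (finSupport T) := by
    refine ⟨hcan.1, fun v hv => ?_⟩
    have hvℓ : (Sum.inr v : Place ℚ) ≠ Sum.inr ℓ := fun h => hv (h ▸ (inr_mem_finSupport_iff T ℓ).mpr hℓT)
    rw [heq' _ hvℓ]
    exact hcan.2 v hv
  -- `χ(𝓕′) = 0` (§1)
  have hχ0 : LocalInvariants.HasCoreRank inv 𝓕' p 0 :=
    hasCoreRank_zero_of_index_eq hperf hsum hcompl hM T hS hle' h𝓕'ur hcan hℓT heq'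
      (by rw [h𝓕'ℓ]; exact hF'idx) hfind hχ1
  -- finiteness of `H¹_{𝓕′}` and `H¹_{𝓕′^*}`
  have hfin' : Finite 𝓕'.selmerGroup :=
    SelmerFinite.finite_selmerGroup_of_isUnramifiedOutside _ (fun v hv => (hS' v hv).2) h𝓕'ur
  have hfind' : Finite (inv.dualSelmerStructure ρ₁ 𝓕').selmerGroup :=
    CoreRankOne.finite_dualSelmerGroup_of_eq_off inv hfind {ℓ}
      (fun v hv => heq' v (hv ℓ (Finset.mem_singleton_self ℓ)))
  have hPS : ∀ q ∈ D.primes, (Sum.inr q : Place ℚ) ∉ finSupport T :=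
    fun q hq h => hPT q hq ((inr_mem_finSupport_iff T q).mp h)
  -- Step 4: `KS(𝓕′) = 0` (Rubin Thm. 2.7.6, n1011) and `KS(𝓕₀) ≤ KS(𝓕′)`
  have hbot : D.kolyvaginSystems 𝓕' = ⊥ :=
    CoreRankZero.kolyvaginSystems_eq_bot_of_hasCoreRank_zero_of_infinite hperf hsum hcompl hM hS' h𝓕'ur
      hfin' hfind' hχ0 hPS hadm hU hT hUT hprime
  have h₀' : 𝓕₀ ≤ 𝓕' := by
    intro v
    by_cases hv : v = Sum.inr ℓ
    · subst hv; rw [h𝓕'ℓ]; exact h₀ℓ.trans hF'u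
    · rw [heq' v hv]; exact h₀ v
  exact le_bot_iff.mp ((kolyvaginSystems_mono D h₀').trans hbot.le)

/-- **Corollary: the classes of every Kolyvagin system for `𝓕₀` vanish** (e.g. the derivative classes `κ_n` of a
Kato-type Euler system in `KS(E[p], 𝓕_u, 𝒫)`, gen 2): `κ` is never primitive. [cite: MazurRubin2004, Prop. 6.2.6 (p. 75)] -/
theorem isKolyvaginSystem_apply_eq_zero_of_dvd_localTamagawaNumber
    [Finite (geomTorsion W ((p : ℤ) ^ 0 * (p : ℤ)))] {inv : LocalInvariants ℚ p}
    (hperf : inv.IsPerfect) (hsum : inv.SumLocalTermEqZero) (hcompl : inv.SelmerComplement)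
    (T : Finset (HeightOneSpectrum (𝓞 ℚ)))
    (hpT : ∀ v : HeightOneSpectrum (𝓞 ℚ), ((p : ℕ) : 𝓞 ℚ) ∈ v.asIdeal → v ∈ T)
    (hbadT : ∀ v : HeightOneSpectrum (𝓞 ℚ), ¬ W.HasGoodReductionAt v → v ∈ T)
    (hχ1 : LocalInvariants.HasCoreRank inv (propagatedSelmerStructure W p 0) p 1)
    {ℓ : HeightOneSpectrum (𝓞 ℚ)} (hℓp : ((p : ℕ) : 𝓞 ℚ) ∉ ℓ.asIdeal)
    (hc : p ∣ (W.baseChange (ℓ.adicCompletion ℚ)).localTamagawaNumber (ℓ.adicCompletionIntegers ℚ))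
    (L : (tateTorsionDatum W p 0).LocalConditionsAbove p)
    {𝓕₀ : SelmerStructure ρ₁} (h₀ : 𝓕₀ ≤ propagatedSelmerStructure W p 0)
    (h₀ℓ : 𝓕₀ (Sum.inr ℓ) ≤ blochKatoSelmerStructure p (tateTorsionDatum W p 0) L (Sum.inr ℓ))
    {D : KolyvaginDatum ρ₁} (hPT : ∀ q ∈ D.primes, q ∉ T) (hadm : D.IsAdmissible)
    (hU : ∀ q ∈ D.primes, Nat.card (unramifiedSubgroup (GaloisRep.toLocal q ρ₁) 1) = p)
    (hT : ∀ q ∈ D.primes, Nat.card (D.transverse (Sum.inr q)) = p)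
    (hUT : ∀ q ∈ D.primes, unramifiedSubgroup (GaloisRep.toLocal q ρ₁) 1 ⊔ D.transverse (Sum.inr q) = ⊤)
    (hprime : ∀ c : galoisCohomology ρ₁ 1, c ≠ 0 →
      ∀ c' : galoisCohomology (DiscreteGaloisModule.tateDual ρ₁ p) 1, c' ≠ 0 →
      {q ∈ D.primes | galoisCohomology.localization ρ₁ (Sum.inr q) 1 c ≠ 0 ∧
        galoisCohomology.localization (DiscreteGaloisModule.tateDual ρ₁ p) (Sum.inr q) 1 c' ≠ 0}.Infinite)
    {κ : Finset (HeightOneSpectrum (𝓞 ℚ)) → galoisCohomology ρ₁ 1} (hκ : D.IsKolyvaginSystem 𝓕₀ κ)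
    (d : Finset (HeightOneSpectrum (𝓞 ℚ))) : κ d = 0 := by
  have h := kolyvaginSystems_eq_bot_of_dvd_localTamagawaNumber W p hperf hsum hcompl T hpT hbadT hχ1 hℓp hc L
    h₀ h₀ℓ hPT hadm hU hT hUT hprime
  have hκ' : κ ∈ D.kolyvaginSystems 𝓕₀ := (KolyvaginDatum.mem_kolyvaginSystems_iff D 𝓕₀ κ).2 hκ
  rw [h, AddSubgroup.mem_bot] at hκ'
  rw [hκ', Pi.zero_apply]

end RationalCurve

/-! ### §3 `p = 3`: the core rank discharged (n1011's `χ(𝓕_can) = 1` from Tate's local Euler characteristic) -/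

section Three

variable (W : WeierstrassCurve ℚ) [W.IsElliptic]

/-- `E[3^0 · 3]` with its `Γ_ℚ`-action, n1011's level-one spelling. -/
local notation3 "ρ₃" => WeierstrassCurve.torsionGaloisModule W (((3 : ℕ) : ℤ) ^ 0 * ((3 : ℕ) : ℤ))

/-- **The exponent-one Tamagawa defect at `p = 3`, core rank discharged**: §2 with `hχ1` supplied by
n1011's `hasCoreRank_one_propagatedSelmerStructureOne_of_isPerfect_of_localEuler` (`χ(𝓕_can) = 1` for EVERY
`E/ℚ` at `p = 3` from the Poitou–Tate family and Tate's local Euler–Poincaré characteristic `hEP`; the tree's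
`propagatedSelmerStructure W 3 0 = propagatedSelmerStructureOne W 3` is `rfl`).  So at `p = 3`: if
`3 ∣ c_ℓ` for some `ℓ ≠ 3` then `KS(E[3], 𝓕₀, 𝒫) = 0` for every `𝓕₀ ≤ 𝓕_can` inside `𝓕_u` at `ℓ`, given only
the Poitou–Tate family, `hEP`, the two `Finite E[3]` binders and the Kolyvagin-datum shape — the route-W2
reading of «TamDiv∞» at exponent one ([MR04] Prop. 6.2.6 needs `p > 3`). [cite: MazurRubin2004, Prop. 6.2.6 (p. 75)] -/
theorem kolyvaginSystems_eq_bot_of_three_dvd_localTamagawaNumber [Finite (geomTorsion W ((3 : ℕ) : ℤ))]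
    [Finite (geomTorsion W (((3 : ℕ) : ℤ) ^ 0 * ((3 : ℕ) : ℤ)))] {inv : LocalInvariants ℚ 3}
    (hperf : inv.IsPerfect) (hsum : inv.SumLocalTermEqZero) (hcompl : inv.SelmerComplement)
    (hEP : ∀ v : HeightOneSpectrum (𝓞 ℚ), localEulerPoincareCharacteristic (v.adicCompletion ℚ))
    (T : Finset (HeightOneSpectrum (𝓞 ℚ)))
    (h3T : ∀ v : HeightOneSpectrum (𝓞 ℚ), ((3 : ℕ) : 𝓞 ℚ) ∈ v.asIdeal → v ∈ T)
    (hbadT : ∀ v : HeightOneSpectrum (𝓞 ℚ), ¬ W.HasGoodReductionAt v → v ∈ T)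
    {ℓ : HeightOneSpectrum (𝓞 ℚ)} (hℓ3 : ((3 : ℕ) : 𝓞 ℚ) ∉ ℓ.asIdeal)
    (hc : 3 ∣ (W.baseChange (ℓ.adicCompletion ℚ)).localTamagawaNumber (ℓ.adicCompletionIntegers ℚ))
    (L : (tateTorsionDatum W 3 0).LocalConditionsAbove 3)
    {𝓕₀ : SelmerStructure ρ₃} (h₀ : 𝓕₀ ≤ propagatedSelmerStructure W 3 0)
    (h₀ℓ : 𝓕₀ (Sum.inr ℓ) ≤ blochKatoSelmerStructure 3 (tateTorsionDatum W 3 0) L (Sum.inr ℓ))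
    {D : KolyvaginDatum ρ₃} (hPT : ∀ q ∈ D.primes, q ∉ T) (hadm : D.IsAdmissible)
    (hU : ∀ q ∈ D.primes, Nat.card (unramifiedSubgroup (GaloisRep.toLocal q ρ₃) 1) = 3)
    (hT : ∀ q ∈ D.primes, Nat.card (D.transverse (Sum.inr q)) = 3)
    (hUT : ∀ q ∈ D.primes, unramifiedSubgroup (GaloisRep.toLocal q ρ₃) 1 ⊔ D.transverse (Sum.inr q) = ⊤)
    (hprime : ∀ c : galoisCohomology ρ₃ 1, c ≠ 0 →
      ∀ c' : galoisCohomology (DiscreteGaloisModule.tateDual ρ₃ 3) 1, c' ≠ 0 →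
      {q ∈ D.primes | galoisCohomology.localization ρ₃ (Sum.inr q) 1 c ≠ 0 ∧
        galoisCohomology.localization (DiscreteGaloisModule.tateDual ρ₃ 3) (Sum.inr q) 1 c' ≠ 0}.Infinite) :
    D.kolyvaginSystems 𝓕₀ = ⊥ :=
  kolyvaginSystems_eq_bot_of_dvd_localTamagawaNumber W 3 hperf hsum hcompl T h3T hbadT
    (hasCoreRank_one_propagatedSelmerStructureOne_of_isPerfect_of_localEuler W inv hperf hsum hcompl hEP T
      h3T hbadT)
    hℓ3 hc L h₀ h₀ℓ hPT hadm hU hT hUT hprime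

end Three

end Summit.BirchSwinnertonDyer.BirchSwinnertonDyer.Theorems.KimAtThreeD7uTamagawaDefect

end
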